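import Summits.CriticalPhenomena.SAWScalingLimit.Theorems.SAWLeftRightFKGFKGToTraversalBoundWitnessAccWindows
import Summits.CriticalPhenomena.SAWScalingLimit.Theorems.SAWLeftRightFKGFKGToTraversalBoundWitnessAccRest
import Summits.CriticalPhenomena.SAWScalingLimit.Theorems.SAWLeftRightFKGFKGToTraversalBoundWitnessClasses
import Summits.CriticalPhenomena.SAWScalingLimit.Theorems.SAWLeftRightFKGFKGToTraversalBoundWitnessAccPureFar
import Summits.CriticalPhenomena.SAWScalingLimit.Theorems.SAWLeftRightFKGFKGToTraversalBoundWitnessAccFacing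
import Summits.CriticalPhenomena.SAWScalingLimit.Theorems.SAWLeftRightFKGFKGToTraversalBoundWindowTighten
import HarnessLib

/-!
# Witness glue T6, part 3: the window accounting along one outline arc

Crux `SAWLeftRightFKG.FKGToTraversalBound` (stmt-CriticalPhenomena-1878), line `slit-necklace`, lead
prover-line-stmt-CriticalPhenomena-1878-c5-0; witness glue unit T6 (`witness_accounting`, registered), part 3 of 3,
on top of parts 1–2 (`…WitnessAccWindows`, `…WitnessAccRest`) and the three sibling accounts `witness_classChanges`
(`…WitnessClasses`), `acc_pureFar_bound` (`…WitnessAccPureFar`), `acc_facing_transfer` (`…WitnessAccFacing`).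

For a far-tip configuration `cfg`, the free component `F` of the first tip with its carrier component `B`, the
wall-follower tour of `F` from the edge `e₀` at the tip, one of its two tip-to-tip arcs `[m, n]` and a lattice walk
`p` in `F` shadowing that arc (vertex `k` within one lattice unit of the contact at position `φ k`): `p` has fewer
than `Kc = 8 (nfar + #S + 2)² (W + nB + 2)` strictly separated windows across the shell `D(y; σ₁, σ₂)`.
Proof: tighten the windows (`hasSepWindows_tighten`); a window is MIXED (two consecutive contacts in different
classes: `≤ 2 nfar` of them by `witness_classChanges`), PURE FAR (all contacts interior to one non-degenerate far
piece of lower rank, `hchild`: `≤ 4W + 4` per piece by `acc_pureFar_bound`) or PURE REST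
(`acc_pure_of_forall_sameCls`); a pure rest window is CHARGED (a representative contact is a defect or the interior
vertex of a degenerate far piece: `≤ 8 (#S + nfar)`, two windows per position and four positions per contact) or
GOOD (both representative contacts off `Λ` by `accr_restFar_notMem`, hence off `B` and facing the boundary,
`accr_facesBoundary`: `≤ 2 nB` by `acc_facing_transfer` on the two strictly separated halves); the four counts
cannot add up to `Kc` (`acc_budget_false`).

All statements folklore; no literature fact; nothing restates the crux.
-/

noncomputable section

open Set
open Literature.Probability.LatticeModels
open Literature.Probability.RandomPlanarGeometry
open Summit.CriticalPhenomena.SAWScalingLimit.Theorems.FKGToTraversalBound.Negative (dom)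

namespace Summit.CriticalPhenomena.SAWScalingLimit.Theorems.FKGToTraversalBound.SlitNecklace

/-- **Witness glue T6 — the window accounting (registered).**  Along one tip-to-tip outline arc of the free
component, a shadowing lattice walk `p` does not have `cfg.Kc W nB` strictly separated windows across
`D(y; σ₁, σ₂)`, granted the rank hypothesis for lower far pieces, the child-side property of the arc and the
boundary budget. [folklore] -/
theorem witness_accounting : ∀ {D : DobrushinDomain} (cfg : FarTipCfg D) (F B : Finset (Site 2)) (e₀ : Site 2 × ODir) (n₁ N m n : ℕ) (p : (zdGraph 2).Walk (bsite (btour (↑F : Set (Site 2)) e₀ m)) (bsite (btour (↑F : Set (Site 2)) e₀ n))) (φ : ℕ → ℕ) (y : ℂ) (σ₁ σ₂ ρ₁ ρ₂ : ℝ) (W nB : ℕ), (∀ x, x ∈ F ↔ x ∈ cfg.Fset) → (∀ x, x ∈ B ↔ x ∈ cfg.Bset) → F ⊆ B → (∀ x ∈ B, x ∈ cfg.Λ) → (∀ x ∈ B, meshPoint cfg.δ x ∈ D.carrier) → (∀ m, cfg.τ ≤ m → m ≤ cfg.τ' → cfg.γ.getVert m ∈ F) → (∀ x ∈ F, x ∉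 cfg.K) → (∀ x ∈ F, ∀ x' ∈ F, ∃ w : (zdGraph 2).Walk x x', ∀ z ∈ w.support, z ∈ F) → (∀ x ∈ F, ∀ x' : Site 2, x' ∉ F → (zdGraph 2).Adj x x' → x' ∈ cfg.K ∨ x' ∈ cfg.C.support) → (∀ x ∈ F, ∀ x' ∈ F, (zdGraph 2).Adj x x' → cfg.G.Adj x x') → (∀ x ∈ B, ∀ x' ∈ B, ∃ w : (zdGraph 2).Walk x x', ∀ z ∈ w.support, z ∈ B) → (∀ x x' : Site 2, x ∉ B → x' ∉ B → ∃ w : (zdGraph 2).Walk x x', ∀ z ∈ w.support, z ∉ B) → (∀ x ∈ B, ∀ x' : Site 2, x' ∉ B → (zdGraph 2).Adj x x' → x' ∈ cfg.C.support) → (∀ x ∈ B, ∀ x' ∈ B, (zdGraph 2).Adj x x' → cfg.G.Adj x x') → (∀ k ∈ cfg.K, ∃ (q : Site 2) (w : (zdGraph 2).Walk k q), q ∈ cfg.C.support ∧ ∀ z ∈ w.support, z ∈ cfg.K ∨ z ∈ cfg.C.support) → IsBEdge (↑F : Set (Site 2)) e₀ → bsite e₀ = cfg.t₀ → bcontact e₀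 = cfg.γ.getVert (cfg.τ - 1) → 0 < n₁ → n₁ < N → btour (↑F : Set (Site 2)) e₀ N = e₀ → (∀ j j', j < N → j' < N → btour (↑F : Set (Site 2)) e₀ j = btour (↑F : Set (Site 2)) e₀ j' → j = j') → bsite (btour (↑F : Set (Site 2)) e₀ n₁) = cfg.t₁ → bcontact (btour (↑F : Set (Site 2)) e₀ n₁) = cfg.γ.getVert (cfg.τ' + 1) → ((m = 0 ∧ n = n₁) ∨ (m = n₁ ∧ n = N)) → (∀ z ∈ p.support, z ∈ F) → Monotone φ → (∀ k, k ≤ p.length → m ≤ φ k ∧ φ k ≤ n ∧ ∀ ii : Fin 2, |(p.getVert k - bcontact (btour (↑F : Set (Site 2)) e₀ (φ k))) ii| ≤ 1) → 0 < σ₁ → σ₁ < σ₂ → 16 * cfg.δ < σ₂ - σ₁ → σ₁ + 4 * cfg.δ ≤ ρ₁ → ρ₂ ≤ σ₂ - 4 * cfg.δ → ρ₁ < ρ₂ → (∀ z : ℂ, σ₁ ≤ dist z y → dist z y ≤ σ₂ → 2 * cfg.η ≤ dist z cfg.ca ∧ 2 * cfg.η ≤ dist z cfg.cb) → (∀ i'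 j', IsFarPiece (meshPoint cfg.δ) cfg.γ (↑cfg.Sp) (↑cfg.S) i' j' cfg.ca cfg.cb cfg.η → cfg.rk i' < cfg.rk cfg.i → ¬ HasSepWindows (meshPoint cfg.δ) cfg.γ (W + 1) (i' + 1) (j' - 1) y (σ₁ + 2 * cfg.δ) (σ₂ - 2 * cfg.δ)) → (∀ (q i'' : ℕ), m < q → q < n → i'' ∈ cfg.farStarts → cfg.NonDeg i'' → i'' ≠ cfg.i → bcontact (btour (↑F : Set (Site 2)) e₀ q) ∈ cfg.V i'' (cfg.pend i'') → cfg.rk i'' < cfg.rk cfg.i) → (∀ (B' : Finset (Site 2)) (e : Site 2 × ODir) (N' q : ℕ) (a b : Fin q → ℕ), (∀ x ∈ B', meshPoint cfg.δ x ∈ D.carrier) → (∀ x ∈ B', ∀ x' ∈ B', (zdGraph 2).Adj x x' → (discreteDomainGraph D.carrier cfg.δ).Adj x x') → (∀ x ∈ B', ∀ x' ∈ B', ∃ w : (zdGraph 2).Walk x x', ∀ z ∈ w.support, z ∈ B') → (∀ x x' : Site 2, x ∉ B' → x' ∉ B' → ∃ w : (zdGraph 2).Walk x x', ∀ z ∈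 w.support, z ∉ B') → IsBEdge (↑B' : Set (Site 2)) e → 0 < N' → btour (↑B' : Set (Site 2)) e N' = e → (∀ j j', j < N' → j' < N' → btour (↑B' : Set (Site 2)) e j = btour (↑B' : Set (Site 2)) e j' → j = j') → (∀ mm, a mm < b mm ∧ b mm < N') → (∀ ⦃mm mm' : Fin q⦄, mm < mm' → b mm < a mm') → (∀ mm, (dist (meshPoint cfg.δ (bsite (btour (↑B' : Set (Site 2)) e (a mm)))) y ≤ ρ₁ ∧ ρ₂ ≤ dist (meshPoint cfg.δ (bsite (btour (↑B' : Set (Site 2)) e (b mm)))) y) ∨ (ρ₂ ≤ dist (meshPoint cfg.δ (bsite (btour (↑B' : Set (Site 2)) e (a mm)))) y ∧ dist (meshPoint cfg.δ (bsite (btour (↑B' : Set (Site 2)) e (b mm)))) y ≤ ρ₁)) → (∀ mm, FacesBoundary D.carrier cfg.δ (btour (↑B' : Set (Site 2)) e (a mm)) ∧ FacesBoundary D.carrier cfg.δ (btour (↑B' : Set (Site 2)) e (b mm))) → q ≤ nB) → ¬ HasSepWindows (meshPoint cfg.δ) p (cfg.Kc W nB) 0 p.length y σ₁ σ₂ :=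 by
  intro D cfg F B e₀ n₁ N m n p φ y σ₁ σ₂ ρ₁ ρ₂ W nB hF hB hFB hBΛ hBD hmid hFK hFconn hFadj hFG hBconn hBcompl
    _hBadj hBG hKatt he₀ he₀s he₀c hn₁ hn₁N hper hinj _hn₁s hn₁c hmn hpF hφ hφb _hσ₁ hσ hwid hρ₁ hρ₂ _hρ hband
    hrank hchild hBB hwin
  classical
  /- basic facts -/
  have hδ := cfg.hδ
  have hidx := cfg.idx_facts
  have hFΛ : ∀ x ∈ F, x ∈ cfg.Λ := fun x hx => hBΛ x (hFB hx)
  have hNpos : 0 < N := by omega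
  have hmn' : m ≤ n ∧ n < m + N := by rcases hmn with ⟨rfl, rfl⟩ | ⟨rfl, rfl⟩ <;> omega
  have hφb' : ∀ k, k ≤ p.length → m ≤ φ k ∧ φ k ≤ n := fun k hk => ⟨(hφb k hk).1, (hφb k hk).2.1⟩
  have h2F : ∃ u ∈ F, ∃ v ∈ F, u ≠ v :=
    ⟨_, hmid _ le_rfl hidx.2.1.le, _, hmid _ hidx.2.1.le le_rfl, fun h =>
      absurd (mono_γ_inj cfg (by omega) (by omega) h) (by omega)⟩
  have h2F' : 2 ≤ F.card := by
    obtain ⟨u, hu, v, hv, huv⟩ := h2F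
    exact Finset.one_lt_card.2 ⟨u, hu, v, hv, huv⟩
  have hBDg : ∀ x ∈ B, ∀ x' ∈ B, (zdGraph 2).Adj x x' → (discreteDomainGraph D.carrier cfg.δ).Adj x x' :=
    fun x hx x' hx' h => ((cfg.hid x x').1 (hBG x hx x' hx' h)).1
  have hclose : ∀ k, k ≤ p.length →
      dist (meshPoint cfg.δ (p.getVert k)) (meshPoint cfg.δ (bcontact (btour (↑F : Set (Site 2)) e₀ (φ k)))) ≤
        2 * cfg.δ := fun k hk => pf_dist_meshPoint_le hδ.le (hφb k hk).2.2
  /- Step 1: tight windows and their representatives -/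
  obtain ⟨a, b, hab, hside, hsep, hint⟩ := hasSepWindows_tighten (meshPoint cfg.δ) p _ 0 p.length y σ₁ σ₂ hσ hwin
  have hrep := fun mm => acc_tight_reps hδ.le p y (by linarith : 2 * cfg.δ < σ₂ - σ₁) (hab mm).2.1 (hab mm).2.2
    (hside mm)
  have hfar : ∀ mm k, a mm < k → k < b mm →
      IsFarPt (meshPoint cfg.δ (bcontact (btour (↑F : Set (Site 2)) e₀ (φ k)))) cfg.ca cfg.cb cfg.η := by
    intro mm k h1 h2
    obtain ⟨hlo, hhi⟩ := hint mm k h1 h2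
    obtain ⟨hca, hcb⟩ := hband _ hlo.le hhi.le
    exact accr_isFarPt_of_near cfg hca hcb (hclose k (by have := (hab mm).2.2; omega))
  /- Step 2: the three kinds of windows -/
  let Ω₀ : Site 2 → Prop := fun z => z ∉ cfg.Λ ∨ z ∈ cfg.Sp ∨ (z ∈ cfg.Ext ∧
    ∀ i'' ∈ cfg.farStarts, cfg.NonDeg i'' → i'' ≠ cfg.i → z ∉ cfg.V i'' (cfg.pend i''))
  let Gd : ℕ → Prop := fun i'' => i'' ∈ cfg.farStarts ∧ cfg.NonDeg i'' ∧ i'' ≠ cfg.i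
  let Vv : ℕ → Set (Site 2) := fun i'' => cfg.V i'' (cfg.pend i'')
  let Same : ℕ → Prop := fun k =>
    (Ω₀ (bcontact (btour (↑F : Set (Site 2)) e₀ (φ k))) ∧ Ω₀ (bcontact (btour (↑F : Set (Site 2)) e₀ (φ (k + 1))))) ∨
      ∃ i'' ∈ cfg.farStarts, cfg.NonDeg i'' ∧ i'' ≠ cfg.i ∧
        bcontact (btour (↑F : Set (Site 2)) e₀ (φ k)) ∈ cfg.V i'' (cfg.pend i'') ∧
          bcontact (btour (↑F : Set (Site 2)) e₀ (φ (k + 1))) ∈ cfg.V i'' (cfg.pend i'')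
  let Mixed : Fin (cfg.Kc W nB) → Prop := fun mm => ∃ k, a mm ≤ k ∧ k < b mm ∧ ¬ Same k
  let PFar : Fin (cfg.Kc W nB) → Prop := fun mm =>
    ∃ i'', Gd i'' ∧ ∀ k, a mm ≤ k → k ≤ b mm → bcontact (btour (↑F : Set (Site 2)) e₀ (φ k)) ∈ Vv i''
  have htri : ∀ mm, ¬ Mixed mm →
      (∀ k, a mm ≤ k → k ≤ b mm → Ω₀ (bcontact (btour (↑F : Set (Site 2)) e₀ (φ k)))) ∨ PFar mm := by
    intro mm hnm
    refine acc_pure_of_forall_sameCls Ω₀ Gd Vv (fun k => bcontact (btour (↑F : Set (Site 2)) e₀ (φ k)))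
      (a mm) (b mm) (fun i'' hg z hz => accr_rest_notMem_V cfg hz hg.1 hg.2.1 hg.2.2)
      (fun i₁ i₂ h₁ h₂ hne => cfg.child_V_disjoint (cfg.child_isPiece_of_mem_farStarts h₁.1)
        (cfg.child_isPiece_of_mem_farStarts h₂.1) hne) (hab mm).2.1 fun k h1 h2 => ?_
    by_contra hns
    refine hnm ⟨k, h1, h2, fun hs => hns ?_⟩
    exact Or.imp_right (fun ⟨i'', hfs, hnd, hne, hA, hB⟩ => ⟨i'', ⟨hfs, hnd, hne⟩, hA, hB⟩) hs
  let Q : Finset (Fin (cfg.Kc W nB)) := Finset.univ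
  let Qmix := Q.filter fun mm => Mixed mm
  let Qfar := Q.filter fun mm => ¬ Mixed mm ∧ PFar mm
  let QΩ := Q.filter fun mm => ¬ Mixed mm ∧ ¬ PFar mm
  have hQ : Q.card = cfg.Kc W nB := by simp [Q]
  have hsplit : Q.card ≤ Qmix.card + Qfar.card + QΩ.card := by
    calc Q.card ≤ (Qmix ∪ Qfar ∪ QΩ).card := Finset.card_le_card fun mm _ => by
            by_cases h1 : Mixed mm <;> by_cases h2 : PFar mm <;>
              simp [Qmix, Qfar, QΩ, Q, Finset.mem_union, Finset.mem_filter, h1, h2]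
      _ ≤ _ := (Finset.card_union_le _ _).trans (Nat.add_le_add_right (Finset.card_union_le _ _) _)
  /- Step 3a: mixed windows carry distinct class changes -/
  have hmix : Qmix.card ≤ 2 * cfg.nfar := by
    have hch : ∀ mm, mm ∈ Qmix → ∃ k, a mm ≤ k ∧ k < b mm ∧ ¬ Same k := fun mm hmm => (Finset.mem_filter.1 hmm).2
    choose! kk hkk using hch
    have hinjk : Set.InjOn kk ↑Qmix := by
      intro mm hmm mm' hmm' h
      obtain ⟨h1, h2, -⟩ := hkk mm hmm
      obtain ⟨h1', h2', -⟩ := hkk mm' hmm'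
      by_contra hne
      rcases lt_or_gt_of_ne hne with hlt | hlt
      · have := hsep hlt; omega
      · have := hsep hlt; omega
    have hcard : (Qmix.image kk).card = Qmix.card := Finset.card_image_of_injOn hinjk
    have key := witness_classChanges cfg F e₀ N m n p.length φ (Qmix.image kk) hF hFΛ hFK hFconn hFadj he₀ hNpos
      hper hinj hmn'.1 hmn'.2 hφ hφb' fun k hk => by
        obtain ⟨mm, hmm, rfl⟩ := Finset.mem_image.1 hk
        obtain ⟨-, h2, h3⟩ := hkk mm hmm
        exact ⟨by have := (hab mm).2.2; omega, h3⟩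
    omega
  /- Step 3b: pure far windows, piece by piece -/
  obtain ⟨T, hT, hTcard⟩ := accr_exists_farFin cfg
  have hfarb : Qfar.card ≤ cfg.nfar * (4 * W + 4) := by
    let Tg := T.filter fun i'' => cfg.NonDeg i'' ∧ i'' ≠ cfg.i
    let Qi : ℕ → Finset (Fin (cfg.Kc W nB)) := fun i'' =>
      Q.filter fun mm => ∀ k, a mm ≤ k → k ≤ b mm → bcontact (btour (↑F : Set (Site 2)) e₀ (φ k)) ∈ Vv i''
    have hsub : Qfar ⊆ Tg.biUnion Qi := by
      intro mm hmm
      obtain ⟨-, -, i'', hg, hV⟩ := Finset.mem_filter.1 hmm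
      exact Finset.mem_biUnion.2 ⟨i'', Finset.mem_filter.2 ⟨(hT i'').2 hg.1, hg.2⟩,
        Finset.mem_filter.2 ⟨Finset.mem_univ _, hV⟩⟩
    have hQi : ∀ i'' ∈ Tg, (Qi i'').card ≤ 4 * W + 4 := by
      intro i'' hi''
      obtain ⟨hiT, hnd, hne⟩ := Finset.mem_filter.1 hi''
      have hfs : i'' ∈ cfg.farStarts := (hT i'').1 hiT
      rcases (Qi i'').eq_empty_or_nonempty with h0 | ⟨mm₀, hmm₀⟩
      · simp [h0]
      have hV₀ := (Finset.mem_filter.1 hmm₀).2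
      have hc₀ := hV₀ (a mm₀) le_rfl (hab mm₀).2.1.le
      -- the position of the first contact is strictly inside the arc
      have hq₀ : m < φ (a mm₀) ∧ φ (a mm₀) < n := by
        obtain ⟨h1, h2⟩ := hφb' _ (by have := hab mm₀; omega : a mm₀ ≤ p.length)
        refine ⟨lt_of_le_of_ne h1 fun h => ?_, lt_of_le_of_ne h2 fun h => ?_⟩
        · refine accr_tip_notMem_V cfg hfs hne ?_ hc₀
          rcases hmn with ⟨hm, -⟩ | ⟨hm, -⟩
          · left; rw [← h, hm, btour_zero, he₀c]
          · right; rw [← h, hm, hn₁c]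
        · refine accr_tip_notMem_V cfg hfs hne ?_ hc₀
          rcases hmn with ⟨-, hn⟩ | ⟨-, hn⟩
          · right; rw [h, hn, hn₁c]
          · left; rw [h, hn, hper, he₀c]
      have hrk : cfg.rk i'' < cfg.rk cfg.i := hchild _ i'' hq₀.1 hq₀.2 hfs hnd hne hc₀
      have hfs' := hfs
      obtain ⟨j', hfp⟩ := hfs'
      have hpj : cfg.pend i'' = j' := cfg.child_pend_eq hfp.1
      have hrk' := hrank i'' j' hfp hrk
      rw [← hpj] at hrk'
      let g := (Qi i'').orderEmbOfFin rfl
      have hg : ∀ k, g k ∈ Qi i'' := fun k => Finset.orderEmbOfFin_mem _ _ k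
      exact acc_pureFar_bound cfg F B e₀ n₁ N m n p φ y σ₁ σ₂ W i'' (Qi i'').card (fun k => a (g k))
        (fun k => b (g k)) hF hB hBΛ h2F' hFK hFconn hFadj hFG hBG hKatt he₀ he₀s he₀c hn₁ hn₁N hper hinj hmn hpF
        hφ hφb hfs hnd hne hσ (by linarith) hrk' (fun k => ⟨(hab (g k)).2.1.le, (hab (g k)).2.2⟩)
        (fun k k' hkk' => hsep (g.strictMono hkk')) (fun k => hside (g k))
        (fun k k' h1 h2 => (Finset.mem_filter.1 (hg k)).2 k' h1 h2)
    calc Qfar.card ≤ (Tg.biUnion Qi).card := Finset.card_le_card hsub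
      _ ≤ Tg.card * (4 * W + 4) := Finset.card_biUnion_le_card_mul _ _ _ hQi
      _ ≤ cfg.nfar * (4 * W + 4) := Nat.mul_le_mul_right _ ((Finset.card_filter_le _ _).trans hTcard.le)
  /- Step 3c: pure rest windows, charged or good -/
  have hΩrep : ∀ mm ∈ QΩ, Ω₀ (bcontact (btour (↑F : Set (Site 2)) e₀ (φ (a mm + 1)))) ∧
      Ω₀ (bcontact (btour (↑F : Set (Site 2)) e₀ (φ (b mm - 1)))) := by
    intro mm hmm
    obtain ⟨-, h1, h2⟩ := Finset.mem_filter.1 hmm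
    have := (hrep mm).1
    rcases htri mm h1 with h | h
    · exact ⟨h _ (by omega) (by omega), h _ (by omega) (by omega)⟩
    · exact absurd h h2
  let Deg : Finset (Site 2) := (T.filter fun i₂ => ¬ cfg.NonDeg i₂).image fun i₂ => cfg.γ.getVert (i₂ + 1)
  have hDeg : Deg.card ≤ cfg.nfar := Finset.card_image_le.trans ((Finset.card_filter_le _ _).trans hTcard.le)
  have hDegspec : ∀ z, z ∉ Deg → ∀ i₂ ∈ cfg.farStarts, ¬ cfg.NonDeg i₂ → z ≠ cfg.γ.getVert (i₂ + 1) := by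
    intro z hz i₂ hi₂ hnd he
    exact hz (Finset.mem_image.2 ⟨i₂, Finset.mem_filter.2 ⟨(hT i₂).2 hi₂, hnd⟩, he.symm⟩)
  let Bad : Site 2 → Prop := fun z => z ∈ cfg.S ∨ z ∈ Deg
  let CH := QΩ.filter fun mm =>
    Bad (bcontact (btour (↑F : Set (Site 2)) e₀ (φ (a mm + 1)))) ∨ Bad (bcontact (btour (↑F : Set (Site 2)) e₀ (φ (b mm - 1))))
  let GOOD := QΩ.filter fun mm =>
    ¬ (Bad (bcontact (btour (↑F : Set (Site 2)) e₀ (φ (a mm + 1)))) ∨ Bad (bcontact (btour (↑F : Set (Site 2)) e₀ (φ (b mm - 1)))))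
  have hΩsplit : QΩ.card ≤ CH.card + GOOD.card := by
    calc QΩ.card ≤ (CH ∪ GOOD).card := Finset.card_le_card fun mm hmm => by
            by_cases h : Bad (bcontact (btour (↑F : Set (Site 2)) e₀ (φ (a mm + 1)))) ∨
                Bad (bcontact (btour (↑F : Set (Site 2)) e₀ (φ (b mm - 1))))
            · exact Finset.mem_union_left _ (Finset.mem_filter.2 ⟨hmm, h⟩)
            · exact Finset.mem_union_right _ (Finset.mem_filter.2 ⟨hmm, h⟩)
      _ ≤ _ := Finset.card_union_le _ _
  -- charged windows: two per position, four positions per contact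
  have hCH : CH.card ≤ 8 * (cfg.S.card + cfg.nfar) := by
    let r : Fin (cfg.Kc W nB) → ℕ := fun mm =>
      if Bad (bcontact (btour (↑F : Set (Site 2)) e₀ (φ (a mm + 1)))) then a mm + 1 else b mm - 1
    have hr : ∀ mm, a mm < r mm ∧ r mm < b mm := fun mm => by
      have := (hrep mm).1
      simp only [r]
      split_ifs <;> omega
    have hrBad : ∀ mm ∈ CH, Bad (bcontact (btour (↑F : Set (Site 2)) e₀ (φ (r mm)))) := fun mm hmm => by
      obtain ⟨-, h⟩ := Finset.mem_filter.1 hmm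
      by_cases h' : Bad (bcontact (btour (↑F : Set (Site 2)) e₀ (φ (a mm + 1))))
      · simp only [r, if_pos h']; exact h'
      · simp only [r, if_neg h']; exact h.resolve_left h'
    let f : Fin (cfg.Kc W nB) → Site 2 × ODir := fun mm =>
      (bcontact (btour (↑F : Set (Site 2)) e₀ (φ (r mm))), (btour (↑F : Set (Site 2)) e₀ (φ (r mm))).2)
    have key := acc_card_le_two_mul_card CH ((cfg.S ∪ Deg) ×ˢ (Finset.univ : Finset ODir)) f
      (fun mm hmm => Finset.mem_product.2 ⟨by simpa [f, Bad, Finset.mem_union] using hrBad mm hmm, Finset.mem_univ _⟩)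
      fun mm₁ h₁ mm₂ _ mm₃ h₃ h12 h23 heq => ?_
    · calc CH.card ≤ 2 * ((cfg.S ∪ Deg) ×ˢ (Finset.univ : Finset ODir)).card := key
        _ = 2 * ((cfg.S ∪ Deg).card * 4) := by rw [Finset.card_product]; simp
        _ ≤ 2 * ((cfg.S.card + cfg.nfar) * 4) := by
          gcongr
          exact (Finset.card_union_le _ _).trans (by omega)
        _ = 8 * (cfg.S.card + cfg.nfar) := by ring
    -- three charged windows at one edge squeeze the middle window onto one contact
    have hc3 : (f mm₁).1 = (f mm₃).1 := congrArg Prod.fst heq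
    have hd3 : (f mm₁).2 = (f mm₃).2 := congrArg Prod.snd heq
    have hE : btour (↑F : Set (Site 2)) e₀ (φ (r mm₁)) = btour (↑F : Set (Site 2)) e₀ (φ (r mm₃)) :=
      acc_edge_eq hc3 hd3
    have hL : ∀ mm, r mm ≤ p.length := fun mm => by have := hr mm; have := hab mm; omega
    have hP : φ (r mm₁) = φ (r mm₃) :=
      acc_btour_pos_inj (↑F : Set (Site 2)) e₀ hn₁ hper hinj hmn hn₁N (hφb' _ (hL mm₁)) (hφb' _ (hL mm₃)) hE
    have hs1 := hsep h12
    have hs2 := hsep h23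
    have hr1 := hr mm₁
    have hr3 := hr mm₃
    have hab2 := hab mm₂
    have hca : φ (a mm₂) = φ (r mm₁) :=
      le_antisymm (by rw [hP]; exact hφ (by omega)) (hφ (by omega))
    have hcb : φ (b mm₂) = φ (r mm₁) :=
      le_antisymm (by rw [hP]; exact hφ (by omega)) (hφ (by omega))
    have hxa := (hφb (a mm₂) (by have := hab mm₂; omega)).2.2
    have hxb := (hφb (b mm₂) (hab mm₂).2.2).2.2
    rw [hca] at hxa
    rw [hcb] at hxb
    have h4 := acc_abs_dist_sub_le_four hδ.le y hxa hxb
    rw [abs_le] at h4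
    rcases hside mm₂ with ⟨h1, h2⟩ | ⟨h1, h2⟩ <;> linarith
  -- good windows: both representative contacts are off `Λ`, hence off `B` and facing the boundary
  have hGOOD : GOOD.card ≤ 2 * nB := by
    have hgood : ∀ mm ∈ GOOD, ∀ k, (k = a mm + 1 ∨ k = b mm - 1) →
        bcontact (btour (↑F : Set (Site 2)) e₀ (φ k)) ∉ B ∧
          FacesBoundary D.carrier cfg.δ (btour (↑F : Set (Site 2)) e₀ (φ k)) := by
      intro mm hmm k hk
      obtain ⟨hmm', hnb⟩ := Finset.mem_filter.1 hmm
      have hkab : a mm < k ∧ k < b mm := by have := (hrep mm).1; rcases hk with rfl | rfl <;> omega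
      obtain ⟨hΩ, hS, hD⟩ : Ω₀ (bcontact (btour (↑F : Set (Site 2)) e₀ (φ k))) ∧
          bcontact (btour (↑F : Set (Site 2)) e₀ (φ k)) ∉ cfg.S ∧ bcontact (btour (↑F : Set (Site 2)) e₀ (φ k)) ∉ Deg := by
        simp only [Bad, not_or] at hnb
        rcases hk with rfl | rfl
        · exact ⟨(hΩrep mm hmm').1, hnb.1.1, hnb.1.2⟩
        · exact ⟨(hΩrep mm hmm').2, hnb.2.1, hnb.2.2⟩
      have hΛ : bcontact (btour (↑F : Set (Site 2)) e₀ (φ k)) ∉ cfg.Λ :=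
        accr_restFar_notMem cfg _ hΩ (hfar mm k hkab.1 hkab.2) hS (hDegspec _ hD)
      exact ⟨fun hb => hΛ (hBΛ _ hb),
        accr_facesBoundary cfg F B hFB hBD hFK hFG hFconn h2F (btour_isBEdge _ he₀ _) hΛ hS⟩
    have hsides : ∀ mm : Fin (cfg.Kc W nB),
        (dist (meshPoint cfg.δ (bsite (btour (↑F : Set (Site 2)) e₀ (φ (a mm + 1))))) y ≤ ρ₁ ∧
            ρ₂ ≤ dist (meshPoint cfg.δ (bsite (btour (↑F : Set (Site 2)) e₀ (φ (b mm - 1))))) y) ∨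
          (ρ₂ ≤ dist (meshPoint cfg.δ (bsite (btour (↑F : Set (Site 2)) e₀ (φ (a mm + 1))))) y ∧
            dist (meshPoint cfg.δ (bsite (btour (↑F : Set (Site 2)) e₀ (φ (b mm - 1))))) y ≤ ρ₁) := by
      intro mm
      obtain ⟨hlt, hs⟩ := hrep mm
      have hbL := (hab mm).2.2
      have ha := acc_dist_bsite_le hδ.le (btour (↑F : Set (Site 2)) e₀ (φ (a mm + 1)))
        (hφb (a mm + 1) (by omega)).2.2
      have hb := acc_dist_bsite_le hδ.le (btour (↑F : Set (Site 2)) e₀ (φ (b mm - 1)))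
        (hφb (b mm - 1) (by omega)).2.2
      have ta := abs_dist_sub_le (meshPoint cfg.δ (bsite (btour (↑F : Set (Site 2)) e₀ (φ (a mm + 1)))))
        (meshPoint cfg.δ (p.getVert (a mm + 1))) y
      have tb := abs_dist_sub_le (meshPoint cfg.δ (bsite (btour (↑F : Set (Site 2)) e₀ (φ (b mm - 1)))))
        (meshPoint cfg.δ (p.getVert (b mm - 1))) y
      rw [abs_le] at ta tb
      rcases hs with ⟨h1, h2⟩ | ⟨h1, h2⟩
      · left; constructor <;> linarith
      · right; constructor <;> linarith
    have hpos : ∀ mm : Fin (cfg.Kc W nB), m ≤ φ (a mm + 1) ∧ φ (a mm + 1) < φ (b mm - 1) ∧ φ (b mm - 1) ≤ n := by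
      intro mm
      obtain ⟨hlt, hs⟩ := hrep mm
      have hL : b mm - 1 ≤ p.length := by have := hab mm; omega
      refine ⟨(hφb' _ (by omega)).1, lt_of_le_of_ne (hφ (by omega)) fun heq => ?_, (hφb' _ hL).2⟩
      have hxa := (hφb (a mm + 1) (by omega)).2.2
      have hxb := (hφb (b mm - 1) hL).2.2
      rw [heq] at hxa
      have h4 := acc_abs_dist_sub_le_four hδ.le y hxa hxb
      rw [abs_le] at h4
      rcases hs with ⟨h1, h2⟩ | ⟨h1, h2⟩ <;> linarith
    have hsepG : ∀ ⦃mm mm' : Fin (cfg.Kc W nB)⦄, mm < mm' → φ (b mm - 1) ≤ φ (a mm' + 1) :=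
      fun mm mm' h => hφ (by have := hsep h; omega)
    let g := GOOD.orderEmbOfFin rfl
    have hg : ∀ k, g k ∈ GOOD := fun k => Finset.orderEmbOfFin_mem _ _ k
    refine acc_le_two_mul_of_halves GOOD.card nB (fun k => φ (a (g k) + 1)) (fun k => φ (b (g k) - 1))
      (fun k => (hpos (g k)).2.1) (fun k k' h => hsepG (g.strictMono h)) fun r ι hι => ?_
    exact acc_facing_transfer D cfg.δ F B e₀ N m n y ρ₁ ρ₂ nB r (fun k => φ (a (g (ι k)) + 1))
      (fun k => φ (b (g (ι k)) - 1)) hFB hFconn hBD hBDg hBconn hBcompl he₀ hNpos hper hinj hmn'.1 hmn'.2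
      (fun k => hpos _) hι (fun k => ⟨(hgood _ (hg _) _ (Or.inl rfl)).1, (hgood _ (hg _) _ (Or.inr rfl)).1⟩)
      (fun k => ⟨(hgood _ (hg _) _ (Or.inl rfl)).2, (hgood _ (hg _) _ (Or.inr rfl)).2⟩) (fun k => hsides _) hBB
  /- Step 4: the budget -/
  have hK : 8 * (cfg.nfar + cfg.S.card + 2) ^ 2 * (W + nB + 2) = Q.card := by rw [hQ]; rfl
  exact acc_budget_false cfg.nfar cfg.S.card W nB Qmix.card Qfar.card CH.card GOOD.card hmix hfarb hCH hGOOD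
    (hK.le.trans (hsplit.trans (Nat.add_le_add_left hΩsplit _)))

end Summit.CriticalPhenomena.SAWScalingLimit.Theorems.FKGToTraversalBound.SlitNecklace

end
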